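import Summits.NavierStokesRegularity.NavierStokesRegularity.Theorems.LerayQuarterDissipationFiniteDissipationLiouvilleApexClasses
import Literature.Analysis.FluidPDE.LerayPressureDecayProofs
import HarnessLib

/-!
# Crux `FiniteDissipationLiouville` (stmt-NavierStokesRegularity-22144): the pressure class and
# the decay at spatial infinity of a member of the finite-dissipation stratum, through the apex
# (file 2/3 of the final-slice leaf)

Theorems file of route `LerayQuarterDissipation` (lead prover g3; `--supports` the crux). Navier–Stokes
regularity is NOT proved by anything here; no summit is.

Continuation of `…ApexClasses.lean`. For a member `u` of the stratum `𝒟` (Type-I ancient mild in the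
KNSS gauge with Leray's quarter-rate dissipation law), classical on `(−∞, 0)` for the pressure `p`:

* `isClassicalNSSolutionOn_sub_normaliser` — renormalising the pressure by a smooth function of
  time keeps the classical solution on the whole past;
* `abs_normaliser_sub_const_le` — the local average `∫ Θ(y) p(t, x₀ − y) dy` of a slice pressure
  `p(t) = Q + C` (`Q` the Calderón–Zygmund pressure, `‖Q‖_{L³} ≤ P`) differs from the constant `C`
  by at most `B_Θ |B̄|^{2/3} P` (Hölder on the ball);
* `exists_normalised_pressure` — **the pressure class through the apex**: there is ONE smooth
  function of time `m` such that `(u, p − m)` is classical on `(−∞, 0)` and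
  `p − m ∈ L^{3/2}((−T, 0) × B(0, R))` for EVERY `T, R > 0` (Chae–Wolf 2017, Step 2 (2.4b) with
  `q = 6`: `‖Q(t)‖₃ ≲ ‖u(t)‖₆² ≲ (−t)^{−1/2}`, so the slice `L^{3/2}` norms are `O((−t)^{−3/4})`,
  integrable at the apex; the tree's `lintegral_ball_pressure_sub_le` on each ball, and the
  comparison of the normalisers at two scales through `abs_normaliser_sub_const_le`);
* `tendsto_setLIntegral_ball_cocompact`, `tendsto_lintegral_slab_ball_cocompact` — **decay at
  spatial infinity through the apex**: `∫₋ₜ⁰ ∫_{B(x₀,R)} |u|² → 0` as `|x₀| → ∞` (dominated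
  convergence in time against `|B_R|^{2/3} ‖u(t)‖₆² ≲ (−t)^{−1/2}`, and the tails of `|u(t)|⁶ ∈ L¹`).

These are the remaining clauses of Lemarié-Rieusset's local Leray class (Def. 14.1) for the field
shifted to `(0, T)`; the assembly and the final-slice leaf are in `…FinalSlice.lean` (file 3/3).

References: D. Chae, J. Wolf, arXiv:1610.09464, §2 Step 2 (2.4b) and Step 4; P. G. Lemarié-Rieusset,
*The Navier–Stokes Problem in the 21st Century* (2016), Def. 14.1.
-/

noncomputable section

-- the summit and its single sub-problem share the name (CONVENTIONS §1), as in every Theorems file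
set_option linter.dupNamespace false

namespace Summit.NavierStokesRegularity.NavierStokesRegularity.Theorems.FiniteDissipationLiouville.Birth.Apex

open MeasureTheory Set Filter Topology Metric Function
open Literature.Analysis Literature.Analysis.FluidPDE
open Literature.Analysis.FluidPDE.PressureNormalisationL3 (norm_integral_le_of_kernel_bound)
open scoped ENNReal NNReal ContDiff

variable {C K : ℝ} {u : ℝ → EuclideanSpace ℝ (Fin 3) → EuclideanSpace ℝ (Fin 3)}
  {p : ℝ → EuclideanSpace ℝ (Fin 3) → ℝ}

/-! ### Renormalising the pressure by a smooth function of time -/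

/-- **`(u, p − m)` is classical on the whole past** for `m` smooth on `(−∞, 0)` (the momentum
equation only sees `∇p`; cf. `ChaeWolfEnergy.isClassicalNSSolutionOnRegion_sub_normaliser`). -/
theorem isClassicalNSSolutionOn_sub_normaliser {ν : ℝ} (hsol : IsClassicalNSSolutionOn (Iio 0) ν 0 u p)
    {m : ℝ → ℝ} (hm : ContDiffOn ℝ (∞ : WithTop ℕ∞) m (Iio 0)) :
    IsClassicalNSSolutionOn (Iio 0) ν 0 u fun t x => p t x - m t where
  smooth_velocity := hsol.smooth_velocity
  smooth_pressure := by
    have h1 : ContDiffOn ℝ (∞ : WithTop ℕ∞) (fun z : ℝ × EuclideanSpace ℝ (Fin 3) => m z.1)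
        (Iio 0 ×ˢ (univ : Set (EuclideanSpace ℝ (Fin 3)))) :=
      hm.comp contDiffOn_fst fun w hw => (mem_prod.1 hw).1
    exact hsol.smooth_pressure.sub h1
  momentum t ht x := by
    have hg : gradient (fun x => p t x - m t) x = gradient (p t) x := by
      simp only [gradient, fderiv_sub_const]
    rw [hg]
    exact hsol.momentum t ht x
  divFree := hsol.divFree

/-! ### The local average of a slice pressure -/

/-- **The local average of a gauged slice pressure is the gauge constant up to a controlled error.**
If `pr = Q + C` a.e. with `Q ∈ L^{q/2}`, `‖Q‖_{L^{q/2}} ≤ P`, `2 ≤ q`, and `Θ` is a normed bump of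
outer radius `ρ` with `Θ ≤ B_Θ`, then `|∫ Θ(y) pr(x₀ − y) dy − C| ≤ B_Θ |B̄(x₀, ρ)|^{1−2/q} P`
(the average of `Q` against `Θ(x₀ − ·)` is bounded by Hölder on the ball; `∫ Θ = 1`). -/
theorem abs_normaliser_sub_const_le {q : ℝ} (hq : 2 ≤ q) (x₀ : EuclideanSpace ℝ (Fin 3))
    (θ : ContDiffBump (0 : EuclideanSpace ℝ (Fin 3))) {BΘ : ℝ} (hBΘ : ∀ y, θ.normed volume y ≤ BΘ)
    {pr Q : EuclideanSpace ℝ (Fin 3) → ℝ} (hQ : MemLp Q (ENNReal.ofReal (q / 2)) volume)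
    {P : ℝ≥0} (hQP : eLpNorm Q (ENNReal.ofReal (q / 2)) volume ≤ P) {c : ℝ}
    (hae : ∀ᵐ x ∂(volume : Measure (EuclideanSpace ℝ (Fin 3))), pr x = Q x + c) :
    |(∫ y, θ.normed volume y * pr (x₀ - y)) - c| ≤
      BΘ * (((volume : Measure (EuclideanSpace ℝ (Fin 3))).real (closedBall x₀ θ.rOut)) ^
        (1 - 2 / q) * (P : ℝ)) := by
  set ρ := θ.rOut with hρ
  set Θ := θ.normed volume with hΘ
  have hq21 : (1 : ℝ≥0∞) ≤ ENNReal.ofReal (q / 2) := by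
    rw [← ENNReal.ofReal_one]; exact ENNReal.ofReal_le_ofReal (by linarith)
  have hQloc : LocallyIntegrable Q volume := hQ.locallyIntegrable hq21
  have hΘc : Continuous Θ := θ.continuous_normed
  have hΘcs : HasCompactSupport Θ := θ.hasCompactSupport_normed
  have hBΘ0 : 0 ≤ BΘ := (θ.nonneg_normed 0).trans (hBΘ 0)
  set cQ : ℝ := ∫ y, Θ y * Q (x₀ - y) with hcQ
  have iQ : Integrable (fun y => Θ y * Q (x₀ - y)) volume :=
    (hΘcs.convolutionExists_left (ContinuousLinearMap.lsmul ℝ ℝ : ℝ →L[ℝ] ℝ →L[ℝ] ℝ) hΘc hQloc x₀).integrable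
  have hae' : ∀ᵐ y ∂(volume : Measure (EuclideanSpace ℝ (Fin 3))), pr (x₀ - y) = Q (x₀ - y) + c :=
    ((volume : Measure (EuclideanSpace ℝ (Fin 3))).measurePreserving_sub_left x₀).quasiMeasurePreserving.ae hae
  have hm' : (∫ y, Θ y * pr (x₀ - y)) = cQ + c := by
    calc ∫ y, Θ y * pr (x₀ - y) = ∫ y, (Θ y * Q (x₀ - y) + c * Θ y) := by
          refine integral_congr_ae ?_
          filter_upwards [hae'] with y hy
          rw [hy]; ring
      _ = cQ + c * ∫ y, Θ y := by
          rw [integral_add iQ (θ.integrable_normed.const_mul c), integral_const_mul]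
      _ = cQ + c := by rw [hΘ, θ.integral_normed, mul_one]
  rw [hm', add_sub_cancel_right]
  -- `|cQ| ≤ B_Θ ∫_{B̄} |Q| ≤ B_Θ V^{1-2/q} P`
  rw [hcQ, ← integral_sub_left_eq_self (fun y => Θ y * Q (x₀ - y)) volume x₀]
  simp only [sub_sub_cancel]
  have hF : ∀ y, ‖Θ (x₀ - y) * Q y‖ ≤ BΘ * |Q y| := fun y => by
    rw [norm_mul, Real.norm_of_nonneg (θ.nonneg_normed _), Real.norm_eq_abs]
    exact mul_le_mul_of_nonneg_right (hBΘ _) (abs_nonneg _)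
  have hF0 : ∀ y, ρ < dist y x₀ → Θ (x₀ - y) * Q y = 0 := fun y hy => by
    have : Θ (x₀ - y) = 0 := by
      have hns : x₀ - y ∉ Function.support Θ := by
        rw [hΘ, θ.support_normed_eq, mem_ball_zero_iff, not_lt, ← dist_eq_norm, dist_comm]
        exact hy.le
      simpa [Function.mem_support] using hns
    rw [this, zero_mul]
  have hFm : AEStronglyMeasurable (fun y => Θ (x₀ - y) * Q y) volume :=
    ((hΘc.comp (continuous_const.sub continuous_id)).aestronglyMeasurable).mul hQ.1
  obtain ⟨-, hI⟩ := norm_integral_le_of_kernel_bound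
    ((hQloc.integrableOn_isCompact (isCompact_closedBall x₀ ρ)).abs) hFm hF hF0
  rw [← Real.norm_eq_abs]
  refine hI.trans (mul_le_mul_of_nonneg_left ?_ hBΘ0)
  exact ChaeWolfEnergy.setIntegral_abs_le x₀ ρ hq hQ hQP

/-! ### The pressure class through the apex -/

/-- **The pressure class through the apex.** A member of the stratum is a classical Navier–Stokes
solution on `(−∞, 0) × ℝ³` for ONE smooth pressure `p` (the Fabes–Jones–Rivière pressure
renormalised by a smooth function of time) which lies in `L^{3/2}((−T, 0) × B(0, R))` for every
`T, R > 0` — the pressure clause of the local Leray class, THROUGH the singular time (Chae–Wolf 2017,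
Step 2 (2.4b)/(2.4c) with `q = 6`: the Calderón–Zygmund pressures of the slices have
`‖Q(t)‖_{L³} ≲ ‖u(t)‖²_{L⁶} ≲ (−t)^{−1/2}`, so the slice `L^{3/2}(B(0,R))` norms of the gauged
pressure are `O((−t)^{−3/4})`). -/
theorem exists_normalised_pressure (hu : IsTypeIAncientMild C u)
    (hlaw : ∀ s : ℝ, s < 0 → ∫⁻ x, ‖fderiv ℝ (u s) x‖ₑ ^ 2 ≤ ENNReal.ofReal (K / Real.sqrt (-s))) :
    ∃ p : ℝ → EuclideanSpace ℝ (Fin 3) → ℝ, IsClassicalNSSolutionOn (Iio 0) 1 0 u p ∧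
      ∀ (T R : ℝ), 0 < T → 0 < R →
        ∫⁻ z in Ioo (-T) 0 ×ˢ ball (0 : EuclideanSpace ℝ (Fin 3)) R,
          ‖p z.1 z.2‖ₑ ^ (3 / 2 : ℝ) < ⊤ := by
  obtain ⟨p₀, hsol⟩ := exists_isClassicalNSSolutionOn_Iio hu
  obtain ⟨A, hA0, hA⟩ := exists_eLpNorm_six_rate hu hlaw
  -- the fixed normaliser at scale `1`
  let θ₁ : ContDiffBump (0 : EuclideanSpace ℝ (Fin 3)) := ⟨1 / 2, 1, by norm_num, by norm_num⟩
  have hθ₁ : θ₁.rOut = 1 := rfl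
  obtain ⟨m₀, hm₀, hm₀val⟩ := ChaeWolfEnergy.exists_smooth_normaliser hsol isOpen_Iio 0 θ₁
  refine ⟨fun t x => p₀ t x - m₀ t, isClassicalNSSolutionOn_sub_normaliser hsol hm₀,
    fun T R hT hR => ?_⟩
  set κ : ℝ := (6 - 3) / (2 * 6) with hκ
  have hκ0 : 0 ≤ κ := by rw [hκ]; norm_num
  have hκ3 : 3 * κ < 1 := by rw [hκ]; norm_num
  have hq2 : (2 : ℝ) < 6 := by norm_num
  have hq3 : (3 : ℝ) ≤ 6 := by norm_num
  have hLq : ∀ t ∈ Ioo (-T) 0, MemLp (u t) (ENNReal.ofReal 6) volume := fun t ht => (hA t ht.2).1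
  have hrate : ∀ t ∈ Ioo (-T) 0,
      eLpNorm (u t) (ENNReal.ofReal 6) volume ≤ ENNReal.ofReal (A * (-t) ^ (-κ)) :=
    fun t ht => (hA t ht.2).2
  -- slice pressures
  obtain ⟨Cq, hQex⟩ := ChaeWolfEnergy.exists_rieszPressure_slice_of_rate hsol hq2 hκ0 hA0 hLq hrate
  choose! Qt hQt hQtb hQteq Ct hCt using hQex
  -- the normaliser at scale `R`
  let θR : ContDiffBump (0 : EuclideanSpace ℝ (Fin 3)) := ⟨R / 2, R, by positivity, by linarith⟩
  have hθR : θR.rOut = R := rfl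
  obtain ⟨mR, -, hmRval⟩ := ChaeWolfEnergy.exists_smooth_normaliser hsol isOpen_Iio 0 θR
  -- sup bounds of the normed bumps
  set BR : ℝ := 1 / (volume : Measure (EuclideanSpace ℝ (Fin 3))).real
    (closedBall (0 : EuclideanSpace ℝ (Fin 3)) θR.rIn) with hBR
  have hBRle : ∀ y, θR.normed volume y ≤ BR := fun y =>
    θR.normed_le_div_measure_closedBall_rIn volume y
  have hBR0 : 0 ≤ BR := (θR.nonneg_normed 0).trans (hBRle 0)
  set B1 : ℝ := 1 / (volume : Measure (EuclideanSpace ℝ (Fin 3))).real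
    (closedBall (0 : EuclideanSpace ℝ (Fin 3)) θ₁.rIn) with hB1
  have hB1le : ∀ y, θ₁.normed volume y ≤ B1 := fun y =>
    θ₁.normed_le_div_measure_closedBall_rIn volume y
  have hB10 : 0 ≤ B1 := (θ₁.nonneg_normed 0).trans (hB1le 0)
  -- constants
  set Vc : ℝ := (volume : Measure (EuclideanSpace ℝ (Fin 3))).real
    (closedBall (0 : EuclideanSpace ℝ (Fin 3)) R) with hVc
  set Vb : ℝ := (volume : Measure (EuclideanSpace ℝ (Fin 3))).real
    (ball (0 : EuclideanSpace ℝ (Fin 3)) R) with hVb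
  set V1 : ℝ := (volume : Measure (EuclideanSpace ℝ (Fin 3))).real
    (closedBall (0 : EuclideanSpace ℝ (Fin 3)) 1) with hV1
  have hVc0 : 0 ≤ Vc := measureReal_nonneg
  have hVb0 : 0 ≤ Vb := measureReal_nonneg
  have hV10 : 0 ≤ V1 := measureReal_nonneg
  set E : ℝ := BR * Vc ^ (1 - 2 / 6 : ℝ) + B1 * V1 ^ (1 - 2 / 6 : ℝ) with hE
  have hE0 : 0 ≤ E := by positivity
  set G : ℝ := (Cq : ℝ) ^ (3 / 2 : ℝ) * A ^ 3 with hG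
  have hG0 : 0 ≤ G := by positivity
  set D : ℝ := (2 : ℝ) ^ (1 / 2 : ℝ) * ((2 : ℝ) ^ (1 / 2 : ℝ) *
      (Vc ^ (1 - 3 / 6 : ℝ) * G + Vb * ((BR * Vc ^ (1 - 2 / 6 : ℝ)) ^ (3 / 2 : ℝ) * G)) +
    Vb * (E ^ (3 / 2 : ℝ) * G)) with hD
  have hD0 : 0 ≤ D := by positivity
  -- ### the slice bound
  have hslice : ∀ t ∈ Ioo (-T) 0,
      ∫⁻ x in ball (0 : EuclideanSpace ℝ (Fin 3)) R, ‖p₀ t x - m₀ t‖ₑ ^ (3 / 2 : ℝ) ≤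
        ENNReal.ofReal (D * (-t) ^ (-(3 * κ))) := by
    intro t ht
    have ht0 : 0 < -t := by linarith [ht.2]
    set M : ℝ≥0 := (A * (-t) ^ (-κ)).toNNReal with hM
    have hMval : (M : ℝ) = A * (-t) ^ (-κ) :=
      Real.coe_toNNReal _ (mul_nonneg hA0 (Real.rpow_nonneg ht0.le _))
    have hvM : eLpNorm (u t) (ENNReal.ofReal 6) volume ≤ M := hrate t ht
    set P : ℝ≥0 := Cq * M ^ 2 with hP
    have hQP : eLpNorm (Qt t) (ENNReal.ofReal (6 / 2)) volume ≤ P := by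
      calc eLpNorm (Qt t) (ENNReal.ofReal (6 / 2)) volume
          ≤ Cq * eLpNorm (u t) (ENNReal.ofReal 6) volume ^ 2 := hQtb t ht
        _ ≤ Cq * (M : ℝ≥0∞) ^ 2 := by gcongr
        _ = (P : ℝ≥0∞) := by rw [hP]; push_cast; ring
    have hPval : (P : ℝ) = Cq * (A * (-t) ^ (-κ)) ^ 2 := by
      rw [hP, NNReal.coe_mul, NNReal.coe_pow, hMval]
    have hP0 : 0 ≤ (P : ℝ) := P.coe_nonneg
    obtain ⟨-, -, i32⟩ := ChaeWolfEnergy.rate_pow_identities (κ := κ) hA0 Cq.coe_nonneg ht0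
    have hP32 : (P : ℝ) ^ (3 / 2 : ℝ) = G * (-t) ^ (-(3 * κ)) := by rw [hPval, i32, hG]
    -- (a) the ball bound with the normaliser at scale `R`
    have key := ChaeWolfEnergy.lintegral_ball_pressure_sub_le hq3 0 θR hBRle (hQt t ht) hQP
      (hCt t ht) (hmRval t ht.2)
    rw [hθR] at key
    -- (b) the two normalisers differ by `≤ E P`
    have hdR := abs_normaliser_sub_const_le (q := 6) (by norm_num) 0 θR hBRle (hQt t ht) hQP
      (hCt t ht)
    have hd1 := abs_normaliser_sub_const_le (q := 6) (by norm_num) 0 θ₁ hB1le (hQt t ht) hQP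
      (hCt t ht)
    rw [hθR] at hdR
    rw [hθ₁] at hd1
    have hdiff : |mR t - m₀ t| ≤ E * P := by
      rw [hmRval t ht.2, hm₀val t ht.2]
      calc |(∫ y, θR.normed volume y * p₀ t (0 - y)) - ∫ y, θ₁.normed volume y * p₀ t (0 - y)|
          = |((∫ y, θR.normed volume y * p₀ t (0 - y)) - Ct t) -
              ((∫ y, θ₁.normed volume y * p₀ t (0 - y)) - Ct t)| := by ring_nf
        _ ≤ |(∫ y, θR.normed volume y * p₀ t (0 - y)) - Ct t| +
              |(∫ y, θ₁.normed volume y * p₀ t (0 - y)) - Ct t| := abs_sub _ _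
        _ ≤ BR * (Vc ^ (1 - 2 / 6 : ℝ) * (P : ℝ)) + B1 * (V1 ^ (1 - 2 / 6 : ℝ) * (P : ℝ)) :=
              add_le_add hdR hd1
        _ = E * P := by rw [hE]; ring
    -- (c) the pointwise splitting
    have hsplit : ∀ x, ‖p₀ t x - m₀ t‖ₑ ^ (3 / 2 : ℝ) ≤
        (2 : ℝ≥0∞) ^ (1 / 2 : ℝ) * (‖p₀ t x - mR t‖ₑ ^ (3 / 2 : ℝ) + ‖mR t - m₀ t‖ₑ ^ (3 / 2 : ℝ)) := by
      intro x
      have e : p₀ t x - m₀ t = (p₀ t x - mR t) + (mR t - m₀ t) := by ring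
      rw [e]
      calc ‖(p₀ t x - mR t) + (mR t - m₀ t)‖ₑ ^ (3 / 2 : ℝ)
          ≤ (‖p₀ t x - mR t‖ₑ + ‖mR t - m₀ t‖ₑ) ^ (3 / 2 : ℝ) :=
            ENNReal.rpow_le_rpow (enorm_add_le _ _) (by norm_num)
        _ ≤ _ := add_rpow_threeHalves_le _ _
    -- the constant term
    have hconst : ∫⁻ _ in ball (0 : EuclideanSpace ℝ (Fin 3)) R, ‖mR t - m₀ t‖ₑ ^ (3 / 2 : ℝ) ≤
        ENNReal.ofReal (Vb * (E * (P : ℝ)) ^ (3 / 2 : ℝ)) := by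
      rw [setLIntegral_const, mul_comm, Real.enorm_eq_ofReal_abs,
        ENNReal.ofReal_rpow_of_nonneg (abs_nonneg _) (by norm_num),
        ENNReal.ofReal_mul hVb0, ofReal_measureReal (measure_ball_lt_top).ne]
      gcongr
    have hX0 : 0 ≤ (2 : ℝ) ^ (1 / 2 : ℝ) * (Vc ^ (1 - 3 / 6 : ℝ) * (P : ℝ) ^ (3 / 2 : ℝ) +
        Vb * (BR * (Vc ^ (1 - 2 / 6 : ℝ) * (P : ℝ))) ^ (3 / 2 : ℝ)) := by positivity
    have hY0 : 0 ≤ Vb * (E * (P : ℝ)) ^ (3 / 2 : ℝ) := by positivity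
    -- (d) integrate
    calc ∫⁻ x in ball (0 : EuclideanSpace ℝ (Fin 3)) R, ‖p₀ t x - m₀ t‖ₑ ^ (3 / 2 : ℝ)
        ≤ ∫⁻ x in ball (0 : EuclideanSpace ℝ (Fin 3)) R, (2 : ℝ≥0∞) ^ (1 / 2 : ℝ) *
            (‖p₀ t x - mR t‖ₑ ^ (3 / 2 : ℝ) + ‖mR t - m₀ t‖ₑ ^ (3 / 2 : ℝ)) :=
          lintegral_mono fun x => hsplit x
      _ = (2 : ℝ≥0∞) ^ (1 / 2 : ℝ) *
            ((∫⁻ x in ball (0 : EuclideanSpace ℝ (Fin 3)) R, ‖p₀ t x - mR t‖ₑ ^ (3 / 2 : ℝ)) +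
              ∫⁻ _ in ball (0 : EuclideanSpace ℝ (Fin 3)) R, ‖mR t - m₀ t‖ₑ ^ (3 / 2 : ℝ)) := by
          rw [lintegral_const_mul' _ _ (ENNReal.rpow_ne_top_of_nonneg (by norm_num) ENNReal.ofNat_ne_top),
            lintegral_add_right _ measurable_const]
      _ ≤ (2 : ℝ≥0∞) ^ (1 / 2 : ℝ) *
            (ENNReal.ofReal ((2 : ℝ) ^ (1 / 2 : ℝ) * (Vc ^ (1 - 3 / 6 : ℝ) * (P : ℝ) ^ (3 / 2 : ℝ) +
              Vb * (BR * (Vc ^ (1 - 2 / 6 : ℝ) * (P : ℝ))) ^ (3 / 2 : ℝ))) +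
             ENNReal.ofReal (Vb * (E * (P : ℝ)) ^ (3 / 2 : ℝ))) := by
          gcongr
      _ = ENNReal.ofReal ((2 : ℝ) ^ (1 / 2 : ℝ) *
            ((2 : ℝ) ^ (1 / 2 : ℝ) * (Vc ^ (1 - 3 / 6 : ℝ) * (P : ℝ) ^ (3 / 2 : ℝ) +
              Vb * (BR * (Vc ^ (1 - 2 / 6 : ℝ) * (P : ℝ))) ^ (3 / 2 : ℝ)) +
             Vb * (E * (P : ℝ)) ^ (3 / 2 : ℝ))) := by
          rw [← ENNReal.ofReal_add hX0 hY0, ENNReal.ofReal_mul (by positivity),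
            ← ENNReal.ofReal_rpow_of_nonneg (by norm_num : (0 : ℝ) ≤ 2) (by norm_num),
            ENNReal.ofReal_ofNat]
      _ = ENNReal.ofReal (D * (-t) ^ (-(3 * κ))) := by
          congr 1
          have e1 : (BR * (Vc ^ (1 - 2 / 6 : ℝ) * (P : ℝ))) ^ (3 / 2 : ℝ) =
              (BR * Vc ^ (1 - 2 / 6 : ℝ)) ^ (3 / 2 : ℝ) * (P : ℝ) ^ (3 / 2 : ℝ) := by
            rw [← mul_assoc, Real.mul_rpow (by positivity) hP0]
          have e2 : (E * (P : ℝ)) ^ (3 / 2 : ℝ) = E ^ (3 / 2 : ℝ) * (P : ℝ) ^ (3 / 2 : ℝ) :=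
            Real.mul_rpow hE0 hP0
          rw [e1, e2, hP32, hD]
          ring
  -- ### measurability and Tonelli
  have hsub : Ioo (-T) 0 ×ˢ ball (0 : EuclideanSpace ℝ (Fin 3)) R ⊆
      Iio (0 : ℝ) ×ˢ (univ : Set (EuclideanSpace ℝ (Fin 3))) :=
    prod_mono (fun s hs => (hs.2 : s < 0)) (subset_univ _)
  have hcont : ContinuousOn (uncurry fun t x => p₀ t x - m₀ t) (Iio 0 ×ˢ univ) :=
    hsol.smooth_pressure.continuousOn.sub (hm₀.continuousOn.comp continuousOn_fst fun w hw => hw.1)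
  set F : ℝ × EuclideanSpace ℝ (Fin 3) → ℝ≥0∞ := fun w => ‖p₀ w.1 w.2 - m₀ w.1‖ₑ ^ (3 / 2 : ℝ)
    with hF
  have cF : ContinuousOn F (Iio 0 ×ˢ univ) := by
    have h1 : ContinuousOn (fun w : ℝ × EuclideanSpace ℝ (Fin 3) => ‖p₀ w.1 w.2 - m₀ w.1‖ₑ)
        (Iio 0 ×ˢ univ) := continuous_enorm.comp_continuousOn hcont
    exact ENNReal.continuous_rpow_const.comp_continuousOn h1
  have hFm : AEMeasurable F (((volume : Measure ℝ).restrict (Ioo (-T) 0)).prod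
      ((volume : Measure (EuclideanSpace ℝ (Fin 3))).restrict (ball 0 R))) := by
    rw [← volume_restrict_prod_eq]
    exact (cF.mono hsub).aemeasurable (measurableSet_Ioo.prod measurableSet_ball)
  show ∫⁻ z in Ioo (-T) 0 ×ˢ ball (0 : EuclideanSpace ℝ (Fin 3)) R, F z < ⊤
  rw [volume_restrict_prod_eq, lintegral_prod _ hFm]
  calc ∫⁻ s in Ioo (-T) 0, ∫⁻ x in ball (0 : EuclideanSpace ℝ (Fin 3)) R, F (s, x)
      ≤ ∫⁻ s in Ioo (-T) 0, ENNReal.ofReal (D * (-s) ^ (-(3 * κ))) :=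
        setLIntegral_mono' measurableSet_Ioo fun s hs => hslice s hs
    _ = ENNReal.ofReal (∫ s in Ioo (-T) 0, D * (-s) ^ (-(3 * κ))) := by
        refine (ofReal_integral_eq_lintegral_ofReal
          ((ChaeWolfEnergy.integrableOn_rpow_neg_Ioo hκ3 _).const_mul D) ?_).symm
        refine (ae_restrict_iff' measurableSet_Ioo).2 (ae_of_all _ fun s hs => ?_)
        exact mul_nonneg hD0 (Real.rpow_nonneg (by linarith [hs.2]) _)
    _ < ⊤ := ENNReal.ofReal_lt_top

end Summit.NavierStokesRegularity.NavierStokesRegularity.Theorems.FiniteDissipationLiouville.Birth.Apex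

end
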